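import Summits.QuantumFields.QCD.Theorems.NestedDissectionSeaCoerciveOfDilute
import Summits.QuantumFields.QCD.Theorems.NestedDissectionSeaCoerciveSeaSheetPileup
import Summits.QuantumFields.QCD.Theorems.NestedDissectionSeaCoerciveSeaCensusDominates

/-!
# Route `NestedDissectionSea`, support `CoerciveOfDilute` (stmt-QuantumFields-14759) —
# the residual is exactly the two pile-up laws of crux 13901's picked line

Stubs 1 (`stub_sheetPileupOfSingularSeparator`, the pile-up lemma) and 2 (`stub_censusDominates`,
chirality split + subadditivity of the phase-quenched ratio) of line
`chirality-collapses-pseudospectrum` of the hinge `CoerciveSea` (stmt-QuantumFields-13901) have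
LANDED (`Theorems/NestedDissectionSeaCoerciveSeaSheetPileup.lean`,
`Theorems/NestedDissectionSeaCoerciveSeaCensusDominates.lean`, 2026-08-16). Feeding them to
`coerciveOfDilute_of_pileupLaws` leaves the glue item `CoerciveOfDilute : NegativeCellsDilute →
CoerciveSea` conditional on EXACTLY the two open laws of that line, VERBATIM as registered on
stmt-13901: `stub_chiralPileupRareOfPinned` (A″-law: chiral low modes of the Hermitian Dirichlet
Wilson cell rarely pile sheet weight onto the pinned valence mass) and
`stub_achiralPileupRareOfPinned` (B″-law: the achiral sector likewise). When both land under those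
names, `coerciveOfDilute_of_twoLaws stub_chiralPileupRareOfPinned stub_achiralPileupRareOfPinned`
closes stmt-14759 — before and independently of the line's import stub
`stub_pinnedDilution : NegativeCellsDilute` (stmt-13900). Caveat recorded by the B″ worker
(`NestedDissectionSeaCoerciveSeaAchiralPileupRareOneSite.lean`): both laws quantify over EVERY
dilution-certified regularisation, and on the one-site box `(2,2,2,2)` (in the window iff `b₀ = 2`)
they fail along any such regularisation whose sea mass equals `−4` infinitely often — whether
(ii)+(iii) exclude that is open; if the laws are re-cut with a guard, re-derive this corollary from
`coerciveOfDilute_of_separatorWegnerLaw` (same file as `coerciveOfDilute_of_pileupLaws`), whose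
hypothesis has the same exposure, or fall back on `coerciveOfDilute_of_coerciveSea`. [folklore]
-/

noncomputable section

open scoped BigOperators Classical
open MeasureTheory Filter Matrix
open Literature.MathematicalPhysics.QuantumLattice Literature.MathematicalPhysics.QuantumFieldTheory
  Literature.Probability.LatticeModels
open Summit.QuantumFields.QCD.Theses.NestedDissectionSea
open Summit.QuantumFields.QCD.Cruxes.CoerciveSea.ChiralityCollapsesPseudospectrum

namespace Summit.QuantumFields.QCD.Theorems.NestedDissectionSeaCoerciveOfDilute

/-- **`CoerciveOfDilute` from the two open pile-up laws alone.** Hypotheses: VERBATIM the registered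
stubs `stub_chiralPileupRareOfPinned` (A″-law) and `stub_achiralPileupRareOfPinned` (B″-law) of line
`chirality-collapses-pseudospectrum` of crux stmt-QuantumFields-13901. Conclusion: the glue item
`NegativeCellsDilute → CoerciveSea`. Proof: `coerciveOfDilute_of_pileupLaws` with the LANDED stubs 1
and 2 (`stub_sheetPileupOfSingularSeparator`, `stub_censusDominates`). [folklore] -/
theorem coerciveOfDilute_of_twoLaws
    (h₄ : ∀ (Nf : ℕ) (reg : QCDRegularisation Nf), (Nf = 2 ∨ Nf = 3) → reg.HasMassScaling →
      (reg.scheme 0 0 0).HasAsymptoticScaling → ∀ M₀ : ℝ, 0 ≤ M₀ → ∀ b₀ : ℕ, 2 ≤ b₀ → ∀ ℓ : ℝ, 0 < ℓ →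
      (∀ m : Fin Nf → ℝ, (∀ f, M₀ < m f) → ∃ R : ℝ, 0 < R ∧ (∀ ε : ℝ, 0 < ε → ∀ᶠ k : ℕ in Filter.atTop, ∀ S : ℕ, R ≤ reg.a k * (2 * S + 1) → let N : ℕ := 2 * S + 1; let mq : Fin Nf → ℝ := fun f => reg.mcrit k + reg.a k * m f / reg.Zm k; let wt : GaugeConfig 4 N (Matrix.specialUnitaryGroup (Fin 3) ℂ) → ℝ := fun U => ∏ f, ‖fermionDet (wilsonDirac (fundamentalRep (Fin 3)) U (mq f) 1)‖; let P : (GaugeConfig 4 N (Matrix.specialUnitaryGroup (Fin 3) ℂ) → Prop) → ℝ := fun E => (∫ U, (if E U then (1 : ℝ) else 0) * wt U ∂(wilsonMeasure (d := 4) (L := N) (fundamentalRep (Fin 3)) (reg.β k))) / (∫ U, wt U ∂(wilsonMeasure (d := 4) (L := N) (fundamentalRep (Fin 3)) (reg.β k))); let J : ℕ := Nat.log 2 (⌊ℓ / reg.a k⌋₊ / b₀) + 1; ∃ δ : ℕ → ℝ, ∑ j ∈ Finset.range J, δ j ≤ ε ∧ ∀ j < J, ∀ s : Fin 4 → ℕ,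 (∀ i, b₀ * 2 ^ j ≤ s i ∧ s i < b₀ * 2 ^ (j + 2) ∧ s i ≤ N ∧ (s i : ℝ) * reg.a k ≤ ℓ) → P (fun U => ∃ f, IsSignDefect U (mq f) j s) ≤ δ j) ∧ (∀ M : ℝ, M₀ < M → ∀ᶠ k : ℕ in Filter.atTop, ∀ S : ℕ, R ≤ reg.a k * (2 * S + 1) → let N : ℕ := 2 * S + 1; let mq : Fin Nf → ℝ := fun f => reg.mcrit k + reg.a k * m f / reg.Zm k; let wt : GaugeConfig 4 N (Matrix.specialUnitaryGroup (Fin 3) ℂ) → ℝ := fun U => ∏ f, ‖fermionDet (wilsonDirac (fundamentalRep (Fin 3)) U (mq f) 1)‖; (1 / 4 : ℝ) ≤ (∫ U, (if (fermionDet (wilsonDirac (fundamentalRep (Fin 3)) U (reg.mcrit k - reg.a k * M / reg.Zm k) 1)).re < 0 then (1 : ℝ) else 0) * wt U ∂(wilsonMeasure (d := 4) (L := N) (fundamentalRep (Fin 3)) (reg.β k))) / (∫ U, wt U ∂(wilsonMeasure (d := 4) (L := N) (fundamentalRep (Fin 3)) (reg.β k))))) →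
      ∃ M₁ : ℝ, M₀ ≤ M₁ ∧ ∀ χ₀ : ℝ, 0 < χ₀ → χ₀ ≤ 1 → ∀ m : Fin Nf → ℝ, (∀ f, M₁ < m f) →
      ∃ R : ℝ, 0 < R ∧ ∃ C : ℝ, 0 < C ∧ ∃ α : ℝ, 0 < α ∧ ∀ᶠ k : ℕ in Filter.atTop, ∀ S : ℕ, R ≤ reg.a k * (2 * S + 1) → let N : ℕ := 2 * S + 1; let mq : Fin Nf → ℝ := fun f => reg.mcrit k + reg.a k * m f / reg.Zm k; let wt : GaugeConfig 4 N (Matrix.specialUnitaryGroup (Fin 3) ℂ) → ℝ := fun U => ∏ f, ‖fermionDet (wilsonDirac (fundamentalRep (Fin 3)) U (mq f) 1)‖; let P : (GaugeConfig 4 N (Matrix.specialUnitaryGroup (Fin 3) ℂ) → Prop) → ℝ := fun E => (∫ U, (if E U then (1 : ℝ) else 0) * wt U ∂(wilsonMeasure (d := 4) (L := N) (fundamentalRep (Fin 3)) (reg.β k))) / (∫ U, wt U ∂(wilsonMeasure (d := 4) (L := N) (fundamentalRep (Fin 3)) (reg.β k))); ∀ s : Fin 4 → ℕ, (∀ i,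 b₀ ≤ s i ∧ s i ≤ N ∧ (s i : ℝ) * reg.a k ≤ ℓ) → (∀ i j, s i ≤ 2 * s j) → ∀ f : Fin Nf, ∀ t : ℝ, 0 < t → t ≤ 1 → P (fun U => ∃ n : ℕ, ∃ u : Fin n → ({p // wilsonBox (0 : TorusSite 4 N) s p} → ℂ), ∃ ev wgt : Fin n → ℝ, (∀ i j, ∑ p, star (u i p) * u j p = if i = j then 1 else 0) ∧ (∀ j, (wilsonCell U (mq f) 0 s).mulVec (u j) = fun p => (ev j : ℂ) * gammaFive p.1.2.2 p.1.2.2 * u j p) ∧ (∀ j, |ev j| < 2 * (t / s 0) ∧ 0 ≤ wgt j ∧ wgt j * |ev j| ≤ 1) ∧ (∀ j, χ₀ ≤ ‖∑ p, star (u j p) * gammaFive p.1.2.2 p.1.2.2 * u j p‖) ∧ 1 / (4 * (t / s 0)) < ∑ j, wgt j * ∑ p, if childrenInterior s p then (0 : ℝ) else ‖u j p‖ ^ 2) ≤ C * t ^ α)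
    (h₅ : ∀ (Nf : ℕ) (reg : QCDRegularisation Nf), (Nf = 2 ∨ Nf = 3) → reg.HasMassScaling →
      (reg.scheme 0 0 0).HasAsymptoticScaling → ∀ M₀ : ℝ, 0 ≤ M₀ → ∀ b₀ : ℕ, 2 ≤ b₀ → ∀ ℓ : ℝ, 0 < ℓ →
      (∀ m : Fin Nf → ℝ, (∀ f, M₀ < m f) → ∃ R : ℝ, 0 < R ∧ (∀ ε : ℝ, 0 < ε → ∀ᶠ k : ℕ in Filter.atTop, ∀ S : ℕ, R ≤ reg.a k * (2 * S + 1) → let N : ℕ := 2 * S + 1; let mq : Fin Nf → ℝ := fun f => reg.mcrit k + reg.a k * m f / reg.Zm k; let wt : GaugeConfig 4 N (Matrix.specialUnitaryGroup (Fin 3) ℂ) → ℝ := fun U => ∏ f, ‖fermionDet (wilsonDirac (fundamentalRep (Fin 3)) U (mq f) 1)‖; let P : (GaugeConfig 4 N (Matrix.specialUnitaryGroup (Fin 3) ℂ) → Prop) → ℝ := fun E => (∫ U, (if E U then (1 : ℝ) else 0) * wt U ∂(wilsonMeasure (d := 4) (L := N) (fundamentalRep (Fin 3)) (reg.β k)))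 / (∫ U, wt U ∂(wilsonMeasure (d := 4) (L := N) (fundamentalRep (Fin 3)) (reg.β k))); let J : ℕ := Nat.log 2 (⌊ℓ / reg.a k⌋₊ / b₀) + 1; ∃ δ : ℕ → ℝ, ∑ j ∈ Finset.range J, δ j ≤ ε ∧ ∀ j < J, ∀ s : Fin 4 → ℕ, (∀ i, b₀ * 2 ^ j ≤ s i ∧ s i < b₀ * 2 ^ (j + 2) ∧ s i ≤ N ∧ (s i : ℝ) * reg.a k ≤ ℓ) → P (fun U => ∃ f, IsSignDefect U (mq f) j s) ≤ δ j) ∧ (∀ M : ℝ, M₀ < M → ∀ᶠ k : ℕ in Filter.atTop, ∀ S : ℕ, R ≤ reg.a k * (2 * S + 1) → let N : ℕ := 2 * S + 1; let mq : Fin Nf → ℝ := fun f => reg.mcrit k + reg.a k * m f / reg.Zm k; let wt : GaugeConfig 4 N (Matrix.specialUnitaryGroup (Fin 3) ℂ) → ℝ := fun U => ∏ f, ‖fermionDet (wilsonDirac (fundamentalRep (Fin 3)) U (mq f) 1)‖; (1 / 4 : ℝ) ≤ (∫ U, (if (fermionDet (wilsonDirac (fundamentalRep (Fin 3)) U (reg.mcrit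 k - reg.a k * M / reg.Zm k) 1)).re < 0 then (1 : ℝ) else 0) * wt U ∂(wilsonMeasure (d := 4) (L := N) (fundamentalRep (Fin 3)) (reg.β k))) / (∫ U, wt U ∂(wilsonMeasure (d := 4) (L := N) (fundamentalRep (Fin 3)) (reg.β k))))) →
      ∃ M₁ : ℝ, M₀ ≤ M₁ ∧ ∃ χ₀ : ℝ, 0 < χ₀ ∧ χ₀ ≤ 1 ∧ ∀ m : Fin Nf → ℝ, (∀ f, M₁ < m f) →
      ∃ R : ℝ, 0 < R ∧ ∃ C : ℝ, 0 < C ∧ ∃ α : ℝ, 0 < α ∧ ∀ᶠ k : ℕ in Filter.atTop, ∀ S : ℕ, R ≤ reg.a k * (2 * S + 1) → let N : ℕ := 2 * S + 1; let mq : Fin Nf → ℝ := fun f => reg.mcrit k + reg.a k * m f / reg.Zm k; let wt : GaugeConfig 4 N (Matrix.specialUnitaryGroup (Fin 3) ℂ) → ℝ := fun U => ∏ f, ‖fermionDet (wilsonDirac (fundamentalRep (Fin 3)) U (mq f) 1)‖; let P : (GaugeConfig 4 N (Matrix.specialUnitaryGroup (Fin 3) ℂ) → Prop) → ℝ := fun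 E => (∫ U, (if E U then (1 : ℝ) else 0) * wt U ∂(wilsonMeasure (d := 4) (L := N) (fundamentalRep (Fin 3)) (reg.β k))) / (∫ U, wt U ∂(wilsonMeasure (d := 4) (L := N) (fundamentalRep (Fin 3)) (reg.β k))); ∀ s : Fin 4 → ℕ, (∀ i, b₀ ≤ s i ∧ s i ≤ N ∧ (s i : ℝ) * reg.a k ≤ ℓ) → (∀ i j, s i ≤ 2 * s j) → ∀ f : Fin Nf, ∀ t : ℝ, 0 < t → t ≤ 1 → P (fun U => ∃ n : ℕ, ∃ u : Fin n → ({p // wilsonBox (0 : TorusSite 4 N) s p} → ℂ), ∃ ev wgt : Fin n → ℝ, (∀ i j, ∑ p, star (u i p) * u j p = if i = j then 1 else 0) ∧ (∀ j, (wilsonCell U (mq f) 0 s).mulVec (u j) = fun p => (ev j : ℂ) * gammaFive p.1.2.2 p.1.2.2 * u j p) ∧ (∀ j, |ev j| < 2 * (t / s 0) ∧ 0 ≤ wgt j ∧ wgt j * |ev j| ≤ 1) ∧ (∀ j, ‖∑ p, star (u j p) * gammaFive p.1.2.2 p.1.2.2 * u j p‖ < χ₀) ∧ 1 / (4 * (t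 / s 0)) < ∑ j, wgt j * ∑ p, if childrenInterior s p then (0 : ℝ) else ‖u j p‖ ^ 2) ≤ C * t ^ α) :
    CoerciveOfDilute :=
  coerciveOfDilute_of_pileupLaws stub_sheetPileupOfSingularSeparator stub_censusDominates h₄ h₅

end Summit.QuantumFields.QCD.Theorems.NestedDissectionSeaCoerciveOfDilute

end
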